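import Mathlib

/-!
# SoloBlind — the Anderson–Das class of level 55 survives at level 110 (a linked-lift certificate)

Finite certificate behind `paper/hafnian-theorem.md` §10.7–10.8 (THEOREM LL, CONJECTURE Z⁺) of the
solo-blind programme on the Kontsevich–Zagier conjecture; companion of `SoloBlindLevelRaising35`
(level 70), `SoloBlindLevelRaising44` (levels 44, 88) and `SoloBlindZ33Outright` (the level-33 class dies
at level 66).

A `GammaMonomial` of level `N` is a list of (index, exponent) pairs encoding `∏ Γ(k/N)^{e_k}`.  The
lattice `D_N` is generated by reflections `e_k + e_{N-k}`, Gauss multiplication units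
`Σ_{j<d} e_{k+jN/d} - e_{dk}` (`d ∣ N`, `d > 1`) and two-term Beta units `β(a,b) - β(a',b')` for Fermat
triples of level `N` with the same CM type `H(a,b) = {u ∈ (ℤ/N)ˣ : ⟨ua⟩ + ⟨ub⟩ + ⟨u(-a-b)⟩ = N}`.

The class.  `v55at110` is the pull-back to level 110 (`Γ(k/55) = Γ(2k/110)`) of Das's canonical lifting
`a_{5,11}` of level 55:
`Γ(3/55)Γ(4/55)Γ(13/55)Γ(14/55)Γ(23/55)Γ(24/55) / (Γ(6/55)Γ(7/55)Γ(10/55)Γ(17/55)Γ(20/55)Γ(21/55))`,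
with all Koblitz–Ogus sums `0` (`ll110_koUnit`).  At level 110 every support-parity (Seo) functional and
every level-110 box functional is even on it (the class is "box-dead" at 110, §10.5), yet it is NOT in
`D₁₁₀`.

The separating functional is the LINKED LIFT (THEOREM LL of §10.8) of one level-55 box of the prime pair
`{5, 11}`: `g = 1_G` with
`G = {12, 32, 78, 98} ∪ {23, 39, 43, 49, 61, 67, 71, 87}` — the four arguments `k/110` of reduced
denominator `55` whose residues are `±1 mod 5` and `±1 mod 11` (the box), plus the eight arguments of
reduced denominator `110` prescribed by the lift `ψ(w) = φ(2c(w)) + φ(c(w))`.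
* `ll110_refl_even`, `ll110_mult_even`: `g` is even on all reflection and multiplication generators
  (`d = 2, 5, 10, 11, 22, 55, 110`);
* `ll110_twoTerm_even`: over the 2016 Fermat triples of level 110 (1756 CM types), equal CM type ⇒ equal
  parity of the number of entries in `G` (checked bucket-wise by CM key mod 64, in four kernel chunks), so `g` is even on every
  two-term unit;
* `ll110_v_odd`: `g` is odd on `v55at110`.
Hence `v55at110 ∉ D₁₁₀`: the first kernel-checked survival of an Anderson–Das class at an even level where
all support and box functionals vanish.
-/

namespace Summit.KontsevichZagierPeriods.KontsevichZagierPeriods.Theorems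
namespace SoloBlind
namespace LinkedLift55

/-- A Γ-monomial of level `N` as a list of (index, exponent) pairs; indices are read mod `N`. -/
abbrev GammaMonomial := List (ℕ × ℤ)

/-- Koblitz–Ogus sum `S_u(e) = Σ e_k ⟨u k⟩_N`. -/
def koSumOf (N u : ℕ) (e : GammaMonomial) : ℤ :=
  e.foldl (fun acc kc => acc + kc.2 * (((u * kc.1) % N : ℕ) : ℤ)) 0

/-- The units mod `N` in `1 … N-1`. -/
def unitsMod (N : ℕ) : List ℕ := (List.range N).filter fun u => Nat.gcd u N == 1

/-- The pull-back to level 110 of Das's class `a_{5,11}` of level 55 (indices `2·55x`). -/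
def v55at110 : GammaMonomial :=
  [(6, 1), (8, 1), (12, -1), (14, -1), (20, -1), (26, 1), (28, 1), (34, -1), (40, -1), (42, -1),
   (46, 1), (48, 1)]

/-- The support `G` of the linked functional `g = 1_G` at level 110 (see the module docstring). -/
def gSet : List ℕ := [12, 23, 32, 39, 43, 49, 61, 67, 71, 78, 87, 98]

/-- Parity functional: is `Σ_{k mod N ∈ G} e_k` even? -/
def gEven (N : ℕ) (e : GammaMonomial) : Bool :=
  (e.foldl (fun acc kc => if gSet.contains (kc.1 % N) then acc + kc.2 else acc) 0) % 2 == 0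

/-- Reflection generators `e_k + e_{N-k}`, `1 ≤ k ≤ N/2`. -/
def reflGens (N : ℕ) : List GammaMonomial :=
  ((List.range (N / 2)).map fun i => [(i + 1, (1 : ℤ)), (N - (i + 1), 1)])

/-- Gauss multiplication generators `Σ_{j<d} e_{k + jN/d} - e_{dk}` for `d ∣ N`, `d > 1`, `1 ≤ k < N/d`. -/
def multGens (N : ℕ) : List GammaMonomial :=
  (((List.range (N + 1)).filter fun d => 1 < d && N % d == 0).map fun d =>
    (List.range (N / d - 1)).map fun i =>
      let k := i + 1
      ((List.range d).map fun j => (k + j * (N / d), (1 : ℤ))) ++ [(d * k, (-1 : ℤ))]).flatten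

/-- CM type of the Fermat triple `(a, b, -a-b)` of level `N`, encoded as a bitmask over the units. -/
def cmKey (N a b : ℕ) : ℕ :=
  (unitsMod N).foldl (fun acc u =>
    2 * acc + (if (u * a) % N + (u * b) % N + (u * (N * N - a - b)) % N == N then 1 else 0)) 0

/-- Fermat triples of level `N` as multisets: `1 ≤ a ≤ b ≤ c ≤ N-1`, `a + b + c ≡ 0 (mod N)`. -/
def fermatTriples (N : ℕ) : List (ℕ × ℕ × ℕ) :=
  (List.range N).flatMap fun a => (List.range N).filterMap fun b =>
    let c := (N * N - a - b) % N
    if 1 ≤ a && a ≤ b && b ≤ c then some (a, b, c) else none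

/-- Parity of the number of entries of a triple lying in `G`. -/
def tripleParity (t : ℕ × ℕ × ℕ) : Bool :=
  ((if gSet.contains t.1 then 1 else 0) + (if gSet.contains t.2.1 then 1 else 0)
    + (if gSet.contains t.2.2 then 1 else 0)) % 2 == 1

/-- Table of (CM type, parity of the number of entries in `G`) over the Fermat triples of level 110. -/
def cmTable110 : List (ℕ × Bool) :=
  (fermatTriples 110).map fun t => (cmKey 110 t.1 t.2.1, tripleParity t)

/-- Bucketed consistency check: rows whose CM key is `≡ r (mod m)` are pairwise consistent
(equal CM type ⇒ equal parity).  Ranging over all residues `r < m` this is equivalent to consistency of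
the whole table, since equal keys fall into the same bucket. -/
def bucketOK (tbl : List (ℕ × Bool)) (m r : ℕ) : Bool :=
  let b := tbl.filter fun x => x.1 % m == r
  b.all fun x => b.all fun y => x.1 != y.1 || x.2 == y.2

set_option maxRecDepth 8192 in
/-- There are 2016 Fermat triples of level 110 (as multisets). -/
theorem triples_card : (fermatTriples 110).length = 2016 := by decide +kernel

set_option maxRecDepth 8192 in
/-- `v55at110` has all Koblitz–Ogus sums equal to `0` at level 110 (all 40 units). -/
theorem ll110_koUnit : ((unitsMod 110).all fun u => koSumOf 110 u v55at110 == 0) = true := by decide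

set_option maxRecDepth 8192 in
/-- Level 110: the functional is even on the 55 reflection generators. -/
theorem ll110_refl_even : ((reflGens 110).all (gEven 110)) = true := by decide +kernel

set_option maxRecDepth 16384 in
/-- Level 110: the functional is even on the multiplication generators (`d = 2, 5, 10, 11, 22, 55, 110`). -/
theorem ll110_mult_even : ((multGens 110).all (gEven 110)) = true := by decide +kernel

set_option maxRecDepth 8192 in
/-- Level 110: the functional is odd on `v55at110` (exactly one entry, `Γ(12/110)⁻¹ = Γ(6/55)⁻¹`, lies in `G`). -/
theorem ll110_v_odd : gEven 110 v55at110 = false := by decide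

set_option maxRecDepth 65536 in
set_option maxHeartbeats 40000000 in
/-- Buckets `r < 16` of CM keys mod 64 are consistent (equal CM type ⇒ equal parity). -/
theorem ll110_bucket_0 : ∀ r < 16, bucketOK cmTable110 64 r = true := by decide +kernel

set_option maxRecDepth 65536 in
set_option maxHeartbeats 40000000 in
/-- Buckets `16 ≤ r < 32` of CM keys mod 64 are consistent. -/
theorem ll110_bucket_1 : ∀ r < 16, bucketOK cmTable110 64 (r + 16) = true := by decide +kernel

set_option maxRecDepth 65536 in
set_option maxHeartbeats 40000000 in
/-- Buckets `32 ≤ r < 48` of CM keys mod 64 are consistent. -/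
theorem ll110_bucket_2 : ∀ r < 16, bucketOK cmTable110 64 (r + 32) = true := by decide +kernel

set_option maxRecDepth 65536 in
set_option maxHeartbeats 40000000 in
/-- Buckets `48 ≤ r < 64` of CM keys mod 64 are consistent. -/
theorem ll110_bucket_3 : ∀ r < 16, bucketOK cmTable110 64 (r + 48) = true := by decide +kernel

/-- Level 110: within every bucket of CM keys mod 64, Fermat triples with the same CM type have the same
parity of the number of entries in `G`; since equal keys share a bucket, this is the full statement:
the functional is even on every two-term unit of level 110 and, with `ll110_refl_even`,
`ll110_mult_even`, `ll110_v_odd`, the pull-back `v55at110` is not in `D₁₁₀`. -/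
theorem ll110_twoTerm_even : ∀ r < 64, bucketOK cmTable110 64 r = true := by
  intro r hr
  have h4 : r < 16 ∨ (16 ≤ r ∧ r < 32) ∨ (32 ≤ r ∧ r < 48) ∨ (48 ≤ r ∧ r < 64) := by omega
  rcases h4 with h | ⟨h1, h2⟩ | ⟨h1, h2⟩ | ⟨h1, h2⟩
  · exact ll110_bucket_0 r h
  · have := ll110_bucket_1 (r - 16) (by omega); rwa [show r - 16 + 16 = r by omega] at this
  · have := ll110_bucket_2 (r - 32) (by omega); rwa [show r - 32 + 32 = r by omega] at this
  · have := ll110_bucket_3 (r - 48) (by omega); rwa [show r - 48 + 48 = r by omega] at this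

end LinkedLift55
end SoloBlind
end Summit.KontsevichZagierPeriods.KontsevichZagierPeriods.Theorems
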